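import Mathlib

/-!
# Wall bubbling for `DoorA26` — WALL EXIT, moment form: member bounds kill the confluent slots of a merged class

LINE / STUBS.  Crux `Theses.LacunarySymmetroid.DoorA26` (stmt-ValiantsHypothesis-19979; OPEN, typed, never asserted), line
`Cruxes/DoorA26/Lines/wall_bubbling.lean` (val-idea-15); serves `Stmt.weylFaces_wall` (rev-3 statement file), EXIT side.  In the (W) chain's tower
currency (W2: `…ClassMoments`, `…ClassTower`, `…LevelSelection`) a value class with members `i ∈ ι`, coefficients `a_i^ν`, deviations `ε_i^ν`
(`|ε_i^ν| ≤ w_ν → 0`) and cluster scale `μ_ν > 0` contributes to the limit object the slots `t^m e^{Et}` whose normalised moments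
`M_m^ν/μ_ν = (Σ_i a_i^ν (ε_i^ν)^m)/μ_ν` have a NON-ZERO limit.  The RELATIVE (D)-SIEVE (`…WallBubblingRelativeDSieve.relative_dSieve`, with
`realisable_classGram` for a relation through the Weyl value) bounds the MEMBERS of a merged disjoint class by the scale.  This file is the
elementary consequence for the moments (def-free, Mathlib only):

* `moment_div_tendsto_zero_of_member_bound` — if EVERY member is `O(μ)` (`|a_i^ν| ≤ C μ_ν`) then `M_m^ν/μ_ν → 0` for every `m ≥ 1`: the class keeps
  ONLY its constant slot (case (a) of the wall exit: a disjoint relation among four non-Weyl values, members `{kl, lk, mn, nm}`);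
* `moment_two_div_tendsto_zero_of_weylMerged` — for a class containing a Weyl pair of members `p, q` (any gap `ε_p − ε_q`) and otherwise `O(μ)`
  members: if `|M_1^ν| ≤ μ_ν` (domination by the scale), `|a_p^ν + a_q^ν| ≤ C μ_ν` and `|a_i^ν| ≤ C μ_ν` for `i ∉ {p,q}` (the relative sieve on the
  merged Gram), then `M_2^ν/μ_ν → 0`: the class keeps at most the TWO slots it has in the confluent determinant on the wall (case (b): relation
  `e₀ + e_k = e_l + e_m` through the Weyl value `e₀`, members `{ik, jk, lm}` up to swaps).

With the slot of the merged class gone, the limit object at a `weylFaces_wall` point has `≤ 20` slots and `…ConfluentCount.extSum_zerosWithMultiplicity_le`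
gives `≤ 19` zeros with multiplicity — the door-free exit mechanism checked by the line lead in BOTH cases (bus 2026-08-28T18:39Z case (a), 18:40Z
case (b): «no anatomy stub enters»).  EXTERNAL CHECKS: case (a) is consistent with the (2,4) disjoint wall (no accumulation of nines, located); case (b)
has NO (2,4) analogue (a Weyl pair plus a relation through its value needs five letters) — the kernel is its only check.

ITEMISATION OF `Stmt.weylFaces_wall` (sorted simplex, a Weyl coincidence, no mixed letter relation, not value-generic).  No mixed relation ⇒ no three
equal letters, so the distinct values number `r = 5` (ONE Weyl pair) or `r = 4` (TWO Weyl pairs); «not value-generic ∧ no mixed» ⇒ at least one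
DISJOINT-type relation among four distinct values.  (r = 5)  Two relations never coexist: a second relation among the four non-Weyl values forces
two of them equal; one among them plus one through the Weyl value `e₀` forces the mixed relation `2e_l = e₀ + e_n`; two through `e₀` force
`2e₀ = e_· + e_·` or `2e_k = e_· + e_·` — all excluded.  So EXACTLY ONE relation: case (a) `e_k + e_l = e_m + e_n` — COVERED (lemma 1, `relative_dSieve`
on the block `{k,l,m,n}`); case (b) `e₀ + e_k = e_l + e_m` — COVERED (lemma 2, `relative_dSieve` on the merged Gram `realisable_classGram`, Weyl pair ↦
one letter).  (r = 4, two Weyl pairs `e₀, e₀'` and singles `e_k, e_l`)  exactly one of (c1) `e₀ + e₀' = e_k + e_l`, (c2) `e₀ + e_k = e₀' + e_l`,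
(c3) `e₀ + e_l = e₀' + e_k`: the relative sieve on the merged Gram still bounds the merged class's CONSTANT-moment pieces, but the higher-moment
vanishing needs a two-gap (`w, w'`) analysis not done here — NAMED OPEN sub-strata «weylFaces_wall, two Weyl pairs» (no silent residue).
The WIRING of lemmas 1–2 into W2's multi-class assembly (`levelSelection_multi` indexing) is not in this file.
Nothing in this file bears on (W)/(M)/(R) themselves, on `DoorA26`, on `MatrixDescartes` (stmt-ValiantsHypothesis-18050) or on `VP ≠ VNP`.

Seat val-sym-door-p2 g12 (W1 #14), `--supports stmt-ValiantsHypothesis-19979 --as helper`. [folklore] elementary estimates. [this work] the bookkeeping.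
-/

-- `Summit.ValiantsHypothesis.ValiantsHypothesis.…` repeats a component by the D-0017 layout
-- (single-conjunct summit), which the `dupNamespace` linter flags; the name is mandated.
set_option linter.dupNamespace false

namespace Summit.ValiantsHypothesis.ValiantsHypothesis.Theorems.LacunarySymmetroidMatrixDescartes.WallBubbling

open Finset Filter Topology
open scoped BigOperators

/-- **Member bound ⇒ all higher moments vanish at the scale.**  If `|a_i^ν| ≤ C μ_ν` for every member and `|ε_i^ν| ≤ w_ν → 0`, then for
`m ≥ 1` the normalised moment `(Σ_i a_i^ν (ε_i^ν)^m)/μ_ν` tends to `0`. [folklore] -/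
theorem moment_div_tendsto_zero_of_member_bound {ι : Type*} [Fintype ι] (a ε : ℕ → ι → ℝ) (w μ : ℕ → ℝ) (C : ℝ)
    (hμ : ∀ ν, 0 < μ ν) (hw : ∀ ν i, |ε ν i| ≤ w ν) (hwlim : Tendsto w atTop (𝓝 0))
    (ha : ∀ ν i, |a ν i| ≤ C * μ ν) (m : ℕ) (hm : 1 ≤ m) :
    Tendsto (fun ν => (∑ i, a ν i * ε ν i ^ m) / μ ν) atTop (𝓝 0) := by
  -- bound: `|M_m|/μ ≤ |ι| · |C| · w^m`
  have hbound : ∀ ν, |(∑ i, a ν i * ε ν i ^ m) / μ ν| ≤ (Fintype.card ι : ℝ) * |C| * w ν ^ m := by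
    intro ν
    rw [abs_div, abs_of_pos (hμ ν), div_le_iff₀ (hμ ν)]
    calc |∑ i, a ν i * ε ν i ^ m| ≤ ∑ i, |a ν i * ε ν i ^ m| := Finset.abs_sum_le_sum_abs _ _
      _ ≤ ∑ _i : ι, |C| * μ ν * w ν ^ m := by
          refine Finset.sum_le_sum fun i _ => ?_
          rw [abs_mul, abs_pow]
          have h1 : |a ν i| ≤ |C| * μ ν := (ha ν i).trans (mul_le_mul_of_nonneg_right (le_abs_self C) (hμ ν).le)
          have h2 : |ε ν i| ^ m ≤ w ν ^ m := pow_le_pow_left₀ (abs_nonneg _) (hw ν i) m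
          exact mul_le_mul h1 h2 (pow_nonneg (abs_nonneg _) _) (mul_nonneg (abs_nonneg _) (hμ ν).le)
      _ = (Fintype.card ι : ℝ) * |C| * w ν ^ m * μ ν := by
          rw [Finset.sum_const, Finset.card_univ, nsmul_eq_mul]; ring
  have hlim : Tendsto (fun ν => (Fintype.card ι : ℝ) * |C| * w ν ^ m) atTop (𝓝 0) := by
    have := (hwlim.pow m).const_mul ((Fintype.card ι : ℝ) * |C|)
    rw [zero_pow (by omega), mul_zero] at this
    exact this
  exact squeeze_zero_norm (fun ν => by rw [Real.norm_eq_abs]; exact hbound ν) hlim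

/-- **Weyl-merged class: the `t²`-moment vanishes at the scale.**  Members indexed by `ι` with two distinguished ones `p ≠ q` (the Weyl pair of the
class); if the first moment is dominated by the scale (`|Σ_i a_i ε_i| ≤ μ`), the Weyl pair's SUM and every other member are `O(μ)`, and
`|ε_i| ≤ w → 0`, then `(Σ_i a_i ε_i²)/μ → 0`. [this work] -/
theorem moment_two_div_tendsto_zero_of_weylMerged {ι : Type*} [Fintype ι] [DecidableEq ι] (a ε : ℕ → ι → ℝ) (w μ : ℕ → ℝ) (C : ℝ)
    (p q : ι) (hpq : p ≠ q)
    (hμ : ∀ ν, 0 < μ ν) (hw0 : ∀ ν, 0 ≤ w ν) (hw : ∀ ν i, |ε ν i| ≤ w ν) (hwlim : Tendsto w atTop (𝓝 0))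
    (hM1 : ∀ ν, |∑ i, a ν i * ε ν i| ≤ μ ν)
    (hsum : ∀ ν, |a ν p + a ν q| ≤ C * μ ν) (hother : ∀ ν i, i ≠ p → i ≠ q → |a ν i| ≤ C * μ ν) :
    Tendsto (fun ν => (∑ i, a ν i * ε ν i ^ 2) / μ ν) atTop (𝓝 0) := by
  classical
  -- split off `p` and `q`
  set R : ℕ → ℕ → ℝ := fun m ν => ∑ i ∈ (Finset.univ.erase p).erase q, a ν i * ε ν i ^ m with hR
  have hsplit : ∀ m ν, ∑ i, a ν i * ε ν i ^ m = a ν p * ε ν p ^ m + a ν q * ε ν q ^ m + R m ν := by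
    intro m ν
    rw [← Finset.add_sum_erase _ _ (Finset.mem_univ p), ← Finset.add_sum_erase _ _ (Finset.mem_erase.mpr ⟨hpq.symm, Finset.mem_univ q⟩)]
    simp only [hR]; ring
  -- the rest is `O(μ w^m)`
  have hcard : (((Finset.univ.erase p).erase q).card : ℝ) ≤ Fintype.card ι := by
    exact_mod_cast ((Finset.card_erase_le).trans (Finset.card_erase_le)).trans (Finset.card_univ (α := ι)).le
  have hC0 : 0 ≤ C * μ 0 := (abs_nonneg _).trans (hsum 0)
  have hC : 0 ≤ C := nonneg_of_mul_nonneg_left hC0 (hμ 0) |> fun h => by nlinarith [hμ 0, abs_nonneg (a 0 p + a 0 q), hsum 0]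
  have hRb : ∀ m ν, 1 ≤ m → |R m ν| ≤ (Fintype.card ι : ℝ) * C * μ ν * w ν ^ m := by
    intro m ν hm
    calc |R m ν| ≤ ∑ i ∈ (Finset.univ.erase p).erase q, |a ν i * ε ν i ^ m| := Finset.abs_sum_le_sum_abs _ _
      _ ≤ ∑ _i ∈ (Finset.univ.erase p).erase q, C * μ ν * w ν ^ m := by
          refine Finset.sum_le_sum fun i hi => ?_
          have hiq : i ≠ q := Finset.ne_of_mem_erase hi
          have hip : i ≠ p := Finset.ne_of_mem_erase (Finset.mem_of_mem_erase hi)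
          rw [abs_mul, abs_pow]
          exact mul_le_mul (hother ν i hip hiq) (pow_le_pow_left₀ (abs_nonneg _) (hw ν i) m) (pow_nonneg (abs_nonneg _) _)
            (mul_nonneg hC (hμ ν).le)
      _ = (((Finset.univ.erase p).erase q).card : ℝ) * (C * μ ν * w ν ^ m) := by rw [Finset.sum_const, nsmul_eq_mul]
      _ ≤ (Fintype.card ι : ℝ) * (C * μ ν * w ν ^ m) :=
          mul_le_mul_of_nonneg_right hcard (mul_nonneg (mul_nonneg hC (hμ ν).le) (pow_nonneg (hw0 ν) _))
      _ = (Fintype.card ι : ℝ) * C * μ ν * w ν ^ m := by ring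
  -- from the first moment: `|a_p (ε_p − ε_q)| ≤ (1 + C w + |ι| C w) μ`
  have hgap : ∀ ν, |a ν p * (ε ν p - ε ν q)| ≤ (1 + C * w ν + (Fintype.card ι : ℝ) * C * w ν) * μ ν := by
    intro ν
    have h1 := hM1 ν
    have hs1 := hsplit 1 ν
    simp only [pow_one] at hs1
    rw [hs1] at h1
    -- a_p ε_p + a_q ε_q = (a_p + a_q) ε_q + a_p (ε_p − ε_q)
    have hid : a ν p * (ε ν p - ε ν q) = (a ν p * ε ν p + a ν q * ε ν q + R 1 ν) - (a ν p + a ν q) * ε ν q - R 1 ν := by ring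
    rw [hid]
    have h2 : |(a ν p + a ν q) * ε ν q| ≤ C * μ ν * w ν := by
      rw [abs_mul]; exact mul_le_mul (hsum ν) (hw ν q) (abs_nonneg _) (mul_nonneg hC (hμ ν).le)
    have h3 := hRb 1 ν le_rfl
    rw [pow_one] at h3
    calc |a ν p * ε ν p + a ν q * ε ν q + R 1 ν - (a ν p + a ν q) * ε ν q - R 1 ν|
        ≤ |a ν p * ε ν p + a ν q * ε ν q + R 1 ν| + |(a ν p + a ν q) * ε ν q| + |R 1 ν| := by
          have := abs_sub (a ν p * ε ν p + a ν q * ε ν q + R 1 ν - (a ν p + a ν q) * ε ν q) (R 1 ν)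
          have := abs_sub (a ν p * ε ν p + a ν q * ε ν q + R 1 ν) ((a ν p + a ν q) * ε ν q)
          linarith
      _ ≤ μ ν + C * μ ν * w ν + (Fintype.card ι : ℝ) * C * μ ν * w ν := by linarith
      _ = (1 + C * w ν + (Fintype.card ι : ℝ) * C * w ν) * μ ν := by ring
  -- the second moment: `(a_p + a_q) ε_q² + a_p (ε_p − ε_q)(ε_p + ε_q) + R 2`
  have hbound : ∀ ν, |(∑ i, a ν i * ε ν i ^ 2) / μ ν| ≤
      (C * w ν ^ 2 + (1 + C * w ν + (Fintype.card ι : ℝ) * C * w ν) * (2 * w ν) + (Fintype.card ι : ℝ) * C * w ν ^ 2) := by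
    intro ν
    rw [abs_div, abs_of_pos (hμ ν), div_le_iff₀ (hμ ν), hsplit 2 ν]
    have hid : a ν p * ε ν p ^ 2 + a ν q * ε ν q ^ 2 + R 2 ν
        = (a ν p + a ν q) * ε ν q ^ 2 + a ν p * (ε ν p - ε ν q) * (ε ν p + ε ν q) + R 2 ν := by ring
    rw [hid]
    have h1 : |(a ν p + a ν q) * ε ν q ^ 2| ≤ C * μ ν * w ν ^ 2 := by
      rw [abs_mul, abs_pow]
      exact mul_le_mul (hsum ν) (pow_le_pow_left₀ (abs_nonneg _) (hw ν q) 2) (pow_nonneg (abs_nonneg _) _) (mul_nonneg hC (hμ ν).le)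
    have h2 : |a ν p * (ε ν p - ε ν q) * (ε ν p + ε ν q)| ≤ (1 + C * w ν + (Fintype.card ι : ℝ) * C * w ν) * μ ν * (2 * w ν) := by
      rw [abs_mul]
      refine mul_le_mul (hgap ν) ?_ (abs_nonneg _) ?_
      · calc |ε ν p + ε ν q| ≤ |ε ν p| + |ε ν q| := abs_add_le _ _
          _ ≤ w ν + w ν := add_le_add (hw ν p) (hw ν q)
          _ = 2 * w ν := by ring
      · have : 0 ≤ C * w ν := mul_nonneg hC (hw0 ν)
        have : 0 ≤ (Fintype.card ι : ℝ) * C * w ν := mul_nonneg (mul_nonneg (Nat.cast_nonneg _) hC) (hw0 ν)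
        exact mul_nonneg (by linarith) (hμ ν).le
    have h3 := hRb 2 ν (by norm_num)
    calc |(a ν p + a ν q) * ε ν q ^ 2 + a ν p * (ε ν p - ε ν q) * (ε ν p + ε ν q) + R 2 ν|
        ≤ |(a ν p + a ν q) * ε ν q ^ 2| + |a ν p * (ε ν p - ε ν q) * (ε ν p + ε ν q)| + |R 2 ν| := by
          have := abs_add_le ((a ν p + a ν q) * ε ν q ^ 2 + a ν p * (ε ν p - ε ν q) * (ε ν p + ε ν q)) (R 2 ν)
          have := abs_add_le ((a ν p + a ν q) * ε ν q ^ 2) (a ν p * (ε ν p - ε ν q) * (ε ν p + ε ν q))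
          linarith
      _ ≤ C * μ ν * w ν ^ 2 + (1 + C * w ν + (Fintype.card ι : ℝ) * C * w ν) * μ ν * (2 * w ν)
          + (Fintype.card ι : ℝ) * C * μ ν * w ν ^ 2 := by linarith
      _ = (C * w ν ^ 2 + (1 + C * w ν + (Fintype.card ι : ℝ) * C * w ν) * (2 * w ν) + (Fintype.card ι : ℝ) * C * w ν ^ 2) * μ ν := by
          ring
  have hlim : Tendsto (fun ν => C * w ν ^ 2 + (1 + C * w ν + (Fintype.card ι : ℝ) * C * w ν) * (2 * w ν)
      + (Fintype.card ι : ℝ) * C * w ν ^ 2) atTop (𝓝 0) := by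
    have h := hwlim
    have e : (0 : ℝ) = C * 0 ^ 2 + (1 + C * 0 + (Fintype.card ι : ℝ) * C * 0) * (2 * 0) + (Fintype.card ι : ℝ) * C * 0 ^ 2 := by ring
    rw [e]
    exact ((h.pow 2).const_mul C).add ((((tendsto_const_nhds.add (h.const_mul C)).add (h.const_mul _)).mul (h.const_mul 2))) |>.add
      ((h.pow 2).const_mul _)
  exact squeeze_zero_norm (fun ν => by rw [Real.norm_eq_abs]; exact hbound ν) hlim


/-- Corollary (case (a), limit form): with the member bound, every LIMIT moment of order `m ≥ 1` is `0` — in `classTower_limit`'s currency the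
class polynomial `Σ_{m<n} c_m t^m/m!` of the merged class is the constant `c_0`. [this work] -/
theorem limitMoment_eq_zero_of_member_bound {ι : Type*} [Fintype ι] (a ε : ℕ → ι → ℝ) (w μ : ℕ → ℝ) (C : ℝ)
    (hμ : ∀ ν, 0 < μ ν) (hw : ∀ ν i, |ε ν i| ≤ w ν) (hwlim : Tendsto w atTop (𝓝 0))
    (ha : ∀ ν i, |a ν i| ≤ C * μ ν) (c : ℕ → ℝ) (φ : ℕ → ℕ) (hφ : StrictMono φ)
    (hmom : ∀ m, Tendsto (fun k => (∑ i, a (φ k) i * ε (φ k) i ^ m) / μ (φ k)) atTop (𝓝 (c m))) :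
    ∀ m, 1 ≤ m → c m = 0 := by
  intro m hm
  have h0 := (moment_div_tendsto_zero_of_member_bound a ε w μ C hμ hw hwlim ha m hm).comp hφ.tendsto_atTop
  exact tendsto_nhds_unique (hmom m) h0

/-- Corollary (case (b), limit form): the LIMIT second moment of the Weyl-merged class is `0` — the class polynomial has degree `≤ 1`, as the
class `e₀ + e_k` of the confluent determinant on the wall. [this work] -/
theorem limitMomentTwo_eq_zero_of_weylMerged {ι : Type*} [Fintype ι] [DecidableEq ι] (a ε : ℕ → ι → ℝ) (w μ : ℕ → ℝ) (C : ℝ)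
    (p q : ι) (hpq : p ≠ q)
    (hμ : ∀ ν, 0 < μ ν) (hw0 : ∀ ν, 0 ≤ w ν) (hw : ∀ ν i, |ε ν i| ≤ w ν) (hwlim : Tendsto w atTop (𝓝 0))
    (hM1 : ∀ ν, |∑ i, a ν i * ε ν i| ≤ μ ν)
    (hsum : ∀ ν, |a ν p + a ν q| ≤ C * μ ν) (hother : ∀ ν i, i ≠ p → i ≠ q → |a ν i| ≤ C * μ ν)
    (c₂ : ℝ) (φ : ℕ → ℕ) (hφ : StrictMono φ)
    (hmom : Tendsto (fun k => (∑ i, a (φ k) i * ε (φ k) i ^ 2) / μ (φ k)) atTop (𝓝 c₂)) : c₂ = 0 := by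
  have h0 := (moment_two_div_tendsto_zero_of_weylMerged a ε w μ C p q hpq hμ hw0 hw hwlim hM1 hsum hother).comp hφ.tendsto_atTop
  exact tendsto_nhds_unique hmom h0

end Summit.ValiantsHypothesis.ValiantsHypothesis.Theorems.LacunarySymmetroidMatrixDescartes.WallBubbling
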